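import Literature.AlgebraicGeometry.Motives.GeneratingSectionsSerreTwistClass
import Literature.AlgebraicGeometry.ModuliOfAbelianVarieties.SiegelLinearRigidificationProjective
import Literature.AlgebraicGeometry.AbelianSchemes.PolarizedLevelLocallyRigidifiable
import Literature.AlgebraicGeometry.Modules.ProjectiveFamilyTwistPushforward
import Literature.AlgebraicGeometry.Modules.SerreTwistModBaseChange
import Literature.AlgebraicGeometry.Modules.PushforwardInjectiveResolution
import Literature.AlgebraicGeometry.Morphisms.UpperSemicontinuityH0ZariskiLocal
import HarnessLib

/-!
# A linearly rigidified abelian scheme `X ⊂ 𝐏(J; T)` is a FLAT family with fibrewise Hilbert polynomial `(6n)^g · d`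

Layer `Literature/AlgebraicGeometry/ModuliOfAbelianVarieties`, namespace
`Literature.AlgebraicGeometry.AbelianSchemes.PolarizedAbelianSchemeWithLevel`.  THEOREMS ONLY (no definition, no named fact,
no instance, no notation, no `sorry`).  Cell `hodgecm-mathlib` (D-0151), F-DAG F-6 (H-rep) brick (R4-poly) (B-p11 (g18); word
B-plan1 (g17) 10:56:54Z; census-lite STATUS 10:59:17Z / 11:03:22Z; consumer: the `hPoly` binder of R-C
`SiegelFramedCovariantOfHilb` (B-p18 (g19)) = the «flat, fibrewise Hilbert polynomial `P`» premise of the Hilbert-scheme letter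
`hHilb` at the embedded family `X′ ⊂ 𝐏(J; T)`).  Count-neutral capital: HC_CM is proved only modulo the 7 printed citations until
rung 0 closes — nothing here bears on a summit statement.

[MumfordFogartyKirwan1994] Ch. 7 §2 Prop. 7.3, step «`Φ : H → Hilb_{ℙ_m}^{P(x)}`» (p. 132) with Ch. 6 §2 Prop. 6.13 (p. 123): a
polarised abelian scheme `(X/T, λ)` of relative dimension `g` and type `δ` (`d = ∏ δᵢ`), embedded in `ℙ^m × T` by a linear
rigidification of `L^Δ(λ)³` (Def. 7.5), is a flat family of closed subschemes of `ℙ^m` whose fibres have Hilbert polynomial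
`P(n) = (6n)^g · d` — Riemann–Roch `χ(L^k) = k^g χ(L)` and the vanishing theorem on every geometric fibre ([MumfordAV1970] §16),
with `𝒪(1)|_X ≅ L^Δ(λ)³` ([Hartshorne1977] II Thm. 7.1).  In the tree's currency (★ (8α) `IsLinearRigidification`, ★ (F4)
`IsLinearRigidification.isClosedImmersion_lift` — the `T`-embedding `j = (π, ι) : X ↪ 𝐏(J; T)`, ★ `SerreTwist.twistMod` — `𝒪_X(n)`
along `j ≫ pr₂ = ι`):

* §1 `IsLinearRigidification.flat_lift_comp_fst` — `X ⊂ 𝐏(J; T)` is `T`-flat (the abelian scheme is smooth).  (The global rank of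
  `π_*(L^Δ(λ)^{⊗m})` over a quasi-compact base is ★ `hasRank_pushforward_LDelta_tensorPow_of_compactSpace` of
  `AbelianSchemes/PolarizedLevelPushforwardDetClass`; this file goes fibrewise instead.)
* §2 `IsLinearRigidification.subsingleton_ext_one_and_finrank_fibre_twistMod` — on EVERY field-valued fibre `X₀ = X ×_T Spec K`:
  `Ext¹(𝒪_{X₀}, 𝒪_X(n)|_{X₀}) = 0` and `dim_K Γ(X₀, 𝒪_X(n)|_{X₀}) = (6n)^g · d` (`n ≥ 1`) — through `𝒪_X(n)|_{X_{𝒰ᵢ}} ≅ (L^Δ(λ)³)^{⊗n}`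
  on the pieces of the rigidification (★ `GeneratingSections.nonempty_twistMod_toProj_iso_tensorPow`, the module half of
  Hartshorne II 7.1; ★ `SerreTwist.exists_pullback_twistMod_unitModule_iso`) and ★ V4 / R3 on the restricted triple.
* §3 **`IsLinearRigidification.hasRank_pushforward_twistMod_lift`** — THE HEAD in the F-5 «flat embedded family» currency:
  `HasRank ((p_X)_* 𝒪_X(n)) ((6n)^g · d)` for the family `j : X ↪ 𝐏(J; T)` (★ `hasRank_pushforward_twistMod_of_forall_fieldPoint`);
  **`IsLinearRigidification.hasRank_pushforward_twistMod`** — the same spelled with `π` and `ι`.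

## References
* [MumfordFogartyKirwan1994] D. Mumford, J. Fogarty, F. Kirwan, *Geometric Invariant Theory*, 3rd ed. (1994), Ch. 6 §2 Prop. 6.13
  (p. 123); Ch. 7 §2 Prop. 7.3 (p. 132), Def. 7.5 (p. 130).
* [MumfordAV1970] D. Mumford, *Abelian Varieties* (1970), §16 (Riemann–Roch and the vanishing theorem), §5 Cor. 2 (p. 50).
* [Hartshorne1977] R. Hartshorne, *Algebraic Geometry* (1977), II Thm. 7.1 (p. 150); III Thm. 9.9, Thm. 12.11 (p. 290).
-/

noncomputable section

-- Mathlib's `Over`/pull-back API and `Scheme.Modules` section API are stated across semireducible wrappers.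
set_option backward.isDefEq.respectTransparency false

open CategoryTheory CategoryTheory.Limits CategoryTheory.Abelian AlgebraicGeometry TopologicalSpace
open Literature.AlgebraicGeometry.Motives Literature.AlgebraicGeometry.Modules Literature.AlgebraicGeometry.Morphisms
  Literature.AlgebraicGeometry.ModuliOfAbelianVarieties
open Literature.AlgebraicGeometry.Modules.SerreTwist (twistMod exists_pullback_twistMod_unitModule_iso)

namespace Literature.AlgebraicGeometry.AbelianSchemes

namespace PolarizedAbelianSchemeWithLevel

variable {g N : ℕ} {δ : Fin g → ℕ} (J : Type) {T : Scheme.{0}}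

/-! ## §1 Flatness -/

/-- **The embedded family `j = (π, ι) : X ↪ 𝐏(J; T)` is `T`-flat** — its structure map `j ≫ pr₁ = π` is the (smooth, hence flat)
abelian scheme. [cite: MumfordFogartyKirwan1994, Ch. 7 §2 Prop. 7.3 (p. 132)] -/
theorem IsLinearRigidification.flat_lift_comp_fst
    {P : PolarizedAbelianSchemeWithLevel g N δ T} {ι : P.A.X.left ⟶ projectiveSpaceInt J}
    (_hι : P.IsLinearRigidification J ι) :
    Flat (pullback.lift P.A.X.hom ι (terminal.hom_ext _ _) ≫ projectiveSpaceFst J T) := by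
  rw [pullback.lift_fst]
  haveI : Smooth P.A.X.hom := P.A.isSmooth
  infer_instance

/-! ## §2 The twists `𝒪_X(n)` on the field-valued fibres -/

/-- `(M^{⊗a})^{⊗b} ≅ M^{⊗ab}` for a line bundle `M` (`[M]^{ab}` on both sides, ★ `detClass_tensorPow`, ★ `nonempty_iso_iff_detClass_eq`).
[cite: Hartshorne1977, II Prop. 6.12 and III Ex. 4.5] -/
theorem nonempty_tensorPow_tensorPow_iso {X : Scheme.{0}} {M : X.Modules} (hM : HasRank M 1) (a b : ℕ) :
    Nonempty (tensorPow (tensorPow M a) b ≅ tensorPow M (a * b)) := by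
  have hM₁ := HasRank.isFiniteLocallyFree' hM
  rw [nonempty_iso_iff_detClass_eq (hasRank_tensorPow_one (hasRank_tensorPow_one hM a) b) (hasRank_tensorPow_one hM (a * b))
    (isFiniteLocallyFree_tensorPow (isFiniteLocallyFree_tensorPow hM₁ a) b) (isFiniteLocallyFree_tensorPow hM₁ (a * b)),
    detClass_tensorPow (hasRank_tensorPow_one hM a) (isFiniteLocallyFree_tensorPow hM₁ a) b, detClass_tensorPow hM hM₁ a,
    detClass_tensorPow hM hM₁ (a * b), pow_mul]

/-- **ON EVERY FIELD-VALUED FIBRE `X₀ = X ×_T Spec K` of a linearly rigidified abelian scheme: `H¹(X₀, 𝒪_X(n)|_{X₀}) = 0` and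
`dim_K Γ(X₀, 𝒪_X(n)|_{X₀}) = (6n)^g · d`** (`n ≥ 1`).  The point lies in a piece `𝒰ᵢ` of the rigidification, over which `ι` is the
morphism of a FRAME of `π_*(L^Δ(λ)³)` (★ `IsFrameRigidification`); there `𝒪_X(n) ≅ (L^Δ(λ)³)^{⊗n} ≅ L^Δ(λ)^{⊗3n}` (the module half
of [Hartshorne1977] II Thm. 7.1, ★ `GeneratingSections.nonempty_twistMod_toProj_iso_tensorPow`; `𝒪(n)` pulls back, ★
`SerreTwist.exists_pullback_twistMod_unitModule_iso`), and on the fibre ★ V4 (vanishing) and ★ R3 (Riemann–Roch) apply.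
[cite: MumfordFogartyKirwan1994, Ch. 6 §2 Prop. 6.13 (p. 123) and Ch. 7 §2 Def. 7.5 (p. 130)] [cite: MumfordAV1970, §16]
[cite: Hartshorne1977, II Thm. 7.1 (p. 150)] -/
theorem IsLinearRigidification.subsingleton_ext_one_and_finrank_fibre_twistMod [IsLocallyNoetherian T]
    (πT : T ⟶ Spec (.of ℚ)) {P : PolarizedAbelianSchemeWithLevel g N δ T} {ι : P.A.X.left ⟶ projectiveSpaceInt J}
    (hι : P.IsLinearRigidification J ι) {K : Type} [Field K] {X₀ : Scheme.{0}} (k : X₀ ⟶ P.A.X.left)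
    (f₀ : X₀ ⟶ Spec (.of K)) (x : Spec (.of K) ⟶ T) (H : IsPullback k f₀ P.A.X.hom x) {n : ℕ} (hn : 0 < n) :
    Subsingleton (Ext.{1} (unitModule X₀)
        ((Scheme.Modules.pullback k).obj (twistMod ι (unitModule P.A.X.left) n)) 1) ∧
      Module.finrank Γ(Spec (.of K), ⊤)
        (SecMod ((Scheme.Modules.pullback k).obj (twistMod ι (unitModule P.A.X.left) n)) f₀.appTop.hom ⊤) =
        (6 * n) ^ g * polarizationDegree δ := by
  obtain ⟨𝒰, h𝒰⟩ := hι
  -- the point of `T` under `x` lies in some piece `𝒰ᵢ`; lift `x` through it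
  obtain ⟨i, y, hy⟩ := 𝒰.exists_eq (x.base (IsLocalRing.closedPoint K))
  have hrange : Set.range x.base ⊆ Set.range (𝒰.f i).base := by
    rintro _ ⟨p, rfl⟩
    rw [Subsingleton.elim p (IsLocalRing.closedPoint K)]
    exact ⟨y, hy⟩
  let x' : Spec (.of K) ⟶ 𝒰.X i := IsOpenImmersion.lift (𝒰.f i) x hrange
  have hx' : x' ≫ 𝒰.f i = x := IsOpenImmersion.lift_fac _ _ _
  haveI : IsLocallyNoetherian (𝒰.X i) := isLocallyNoetherian_of_isOpenImmersion (𝒰.f i)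
  -- the frame rigidification of the restricted triple `(P.baseChange (𝒰.f i))` over `𝒰ᵢ`
  obtain ⟨Gr, hGr₁, hGr₂, F, h1, e, hcov, heq⟩ := h𝒰 i
  -- the fibre square of `(P.baseChange (𝒰.f i))` over `x'`
  let k' : X₀ ⟶ (P.baseChange (𝒰.f i)).A.X.left := pullback.lift k (f₀ ≫ x') (by rw [Category.assoc, hx']; exact H.w)
  have hk' : k' ≫ pullback.fst P.A.X.hom (𝒰.f i) = k := pullback.lift_fst _ _ _
  have H' : IsPullback k' f₀ (P.baseChange (𝒰.f i)).A.X.hom x' := by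
    refine IsPullback.of_right ?_ (pullback.lift_snd _ _ _) (IsPullback.of_hasPullback P.A.X.hom (𝒰.f i))
    rw [hk', hx']
    exact H
  -- `𝒪(n)` on `Xᵢ` is `(L^Δ(λᵢ)³)^{⊗n}` (Hartshorne II 7.1, module half) …
  have hD : (GeneratingSections.ofCocycleSections F.U (GeneratingSections.CocycleSections.ofFrameSystem F h1
      fun j ↦ (basisSection e j :)) hcov).toProj (specULiftZIsTerminal.from (P.baseChange (𝒰.f i)).A.X.left) =
      pullback.fst P.A.X.hom (𝒰.f i) ≫ ι := by
    have h := heq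
    rw [Morphisms.projectiveSpace.homEquiv_pointOfSections] at h
    exact h
  obtain ⟨e₃⟩ := GeneratingSections.nonempty_twistMod_toProj_iso_tensorPow (specULiftZIsTerminal.from (P.baseChange (𝒰.f i)).A.X.left) F h1
    (fun j ↦ (basisSection e j :)) hcov n
  rw [hD] at e₃
  -- … and `((L^Δ)³)^{⊗n} ≅ (L^Δ)^{⊗3n}`
  have hL1 : HasRank ((Scheme.Modules.pullback Gr).obj (P.baseChange (𝒰.f i)).D.P) 1 := hasRank_pullback Gr (P.baseChange (𝒰.f i)).D.hasRank_one
  obtain ⟨e₄⟩ := nonempty_tensorPow_tensorPow_iso hL1 3 n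
  -- `𝒪(n)` pulls back along `k = k' ≫ pr` and along `k'`
  obtain ⟨e₁, -⟩ := exists_pullback_twistMod_unitModule_iso k ι n
  obtain ⟨e₂, -⟩ := exists_pullback_twistMod_unitModule_iso k' (pullback.fst P.A.X.hom (𝒰.f i) ≫ ι) n
  have hkι : k ≫ ι = k' ≫ (pullback.fst P.A.X.hom (𝒰.f i) ≫ ι) := by rw [← Category.assoc, hk']
  rw [hkι] at e₁
  -- the comparison isomorphism on `X₀`
  let Φ : (Scheme.Modules.pullback k).obj (twistMod ι (unitModule P.A.X.left) n) ≅
      (Scheme.Modules.pullback k').obj (tensorPow ((Scheme.Modules.pullback Gr).obj (P.baseChange (𝒰.f i)).D.P) (3 * n)) :=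
    e₁ ≪≫ e₂.symm ≪≫ (Scheme.Modules.pullback k').mapIso (e₃ ≪≫ e₄)
  have hm : 0 < 3 * n := by omega
  refine ⟨?_, ?_⟩
  · haveI := (P.baseChange (𝒰.f i)).pol.subsingleton_ext_one_pullback_LDelta_tensorPow' (P.baseChange (𝒰.f i)).A (P.baseChange (𝒰.f i)).D Gr hGr₁ hGr₂ x' H' hm
    exact subsingleton_ext_of_iso (unitModule X₀) Φ 1
  · haveI : CharZero K := charZero_of_specHom πT x
    rw [finrank_secMod_eq_of_iso f₀.appTop.hom Φ,
      (P.baseChange (𝒰.f i)).pol.finrank_secMod_pullback_LDelta_tensorPow (P.baseChange (𝒰.f i)).A (P.baseChange (𝒰.f i)).D (P.baseChange (𝒰.f i)).relDim (P.baseChange (𝒰.f i)).hasType Gr hGr₁ hGr₂ x' H' hm]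
    ring

/-! ## §3 The rank of `(p_X)_* 𝒪_X(n)` -/

/-- **[MumfordFogartyKirwan1994] Prop. 7.3 («`Φ : H → Hilb^{P(x)}`») with Prop. 6.13: a linearly rigidified abelian scheme
`j = (π, ι) : X ↪ 𝐏(J; T)` is a flat embedded family with `(p_X)_* 𝒪_X(n)` LOCALLY FREE OF RANK `P(n) = (6n)^g · d`** for every
`n ≥ 1` (so in particular with fibrewise Hilbert polynomial `P`) — the F-5 «flat family in `𝐏(J; T)`» currency: structure map
`j ≫ pr₁`, twist along `j ≫ pr₂`.  ★ `hasRank_pushforward_twistMod_of_forall_fieldPoint` (cohomology and base change for the twists of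
a flat closed family) fed with §2.
[cite: MumfordFogartyKirwan1994, Ch. 7 §2 Prop. 7.3 (p. 132) and Ch. 6 §2 Prop. 6.13 (p. 123)] [cite: MumfordAV1970, §16]
[cite: Hartshorne1977, III Thm. 12.11 (p. 290)] -/
theorem IsLinearRigidification.hasRank_pushforward_twistMod_lift [IsLocallyNoetherian T] (πT : T ⟶ Spec (.of ℚ))
    {P : PolarizedAbelianSchemeWithLevel g N δ T} {ι : P.A.X.left ⟶ projectiveSpaceInt J}
    (hι : P.IsLinearRigidification J ι) {n : ℕ} (hn : 0 < n) :
    HasRank ((Scheme.Modules.pushforward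
        (pullback.lift P.A.X.hom ι (terminal.hom_ext _ _) ≫ projectiveSpaceFst J T)).obj
      (twistMod (pullback.lift P.A.X.hom ι (terminal.hom_ext _ _) ≫
          pullback.snd (terminal.from T) (terminal.from (projectiveSpaceInt J))) (unitModule P.A.X.left) n))
      ((6 * n) ^ g * polarizationDegree δ) := by
  haveI := hι.isClosedImmersion_lift J πT
  haveI := hι.flat_lift_comp_fst J
  refine hasRank_pushforward_twistMod_of_forall_fieldPoint (pullback.lift P.A.X.hom ι (terminal.hom_ext _ _)) n _
    (fun K _ X₀ k f₀ x H ↦ ?_) (fun K _ X₀ k f₀ x H ↦ ?_) <;>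
    rw [pullback.lift_fst] at H <;> rw [pullback.lift_snd]
  · exact (hι.subsingleton_ext_one_and_finrank_fibre_twistMod J πT k f₀ x H hn).1
  · exact (hι.subsingleton_ext_one_and_finrank_fibre_twistMod J πT k f₀ x H hn).2

/-- **The same, spelled with `π` and `ι`**: `π_* 𝒪_X(n)` (twist along `ι : X → 𝐏^m_ℤ`) is locally free of rank `(6n)^g · d`.
[cite: MumfordFogartyKirwan1994, Ch. 7 §2 Prop. 7.3 (p. 132) and Ch. 6 §2 Prop. 6.13 (p. 123)] -/
theorem IsLinearRigidification.hasRank_pushforward_twistMod [IsLocallyNoetherian T] (πT : T ⟶ Spec (.of ℚ))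
    {P : PolarizedAbelianSchemeWithLevel g N δ T} {ι : P.A.X.left ⟶ projectiveSpaceInt J}
    (hι : P.IsLinearRigidification J ι) {n : ℕ} (hn : 0 < n) :
    HasRank ((Scheme.Modules.pushforward P.A.X.hom).obj (twistMod ι (unitModule P.A.X.left) n))
      ((6 * n) ^ g * polarizationDegree δ) := by
  have h := hι.hasRank_pushforward_twistMod_lift J πT hn
  rwa [pullback.lift_fst, pullback.lift_snd] at h

end PolarizedAbelianSchemeWithLevel

end Literature.AlgebraicGeometry.AbelianSchemes

end
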